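import Literature.NumberTheory.Rogawski1990.RankOneUnstableDeltaValueRamifiedTorus     -- ★ A-p19 (g23) R-4c⁺ ED. 1: `exists_finHeckeValue_sub_inv_eq_mul_hilbertSymbol_of_skew` (η a PARAMETER); brings FILE B, L1, R-4
import Literature.NumberTheory.Rogawski1990.RankOneTorusDepthContinuity              -- ★ F0P3a-p03 (b3): `inv_finHeckeValue_frameEntry_mul_eventually_eq`
import HarnessLib

/-!
# `Δ` along the elliptic torus at a ramified place, UNIFORM version (no tameness): the raw symbol law `Δ(t)·(b₀ t, θ)_v = E t · q^{−⌊(N t − 1)∕2⌋}` (road W′ = «R1LL-WILD», socket (Ψ4-Δ), architect A-44)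

Literature layer for `stmt-HodgeConjecture-24833` (crux H413), line «N6nsGerm», residue «R1-CM-ram-wild»: the (γ) layer ★-to-be `rankOneUnstable_core_of_shellWindow`
(F0P3a-p04 (g14), rf d584ce92) takes binders `(N₁ E hE hΔ)`:
* `hE : ∀ s, ¬ regular s → ∀ᶠ t in 𝓝 s, t ∈ U → E t = E s`,
* `hΔ : ∀ t ∈ U, N₁ ≤ N t → μ_v(a_t)⁻¹ · √(∏‖a_t‖) · ε t = E t · (q ^ ((N t − 1) ∕ 2))⁻¹`,
with `U = {t | (↑t).1 regular}`, `a_t = τ₀ t − τ₁ t` (★ L1 frame entries), `N t = (−log|a_t|_w).toNat`, `q = #(𝓞_{L⁺}∕v)` and the RAW sign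
`ε t := ((b₀ t, θ)_v : ℂ)` (`θ` the CM generator, `b₀ t` the Cayley parameter of `z_t = (τ₀ t)_w ∕ (τ₁ t)_w` for a fixed skew `η`: `ι_w b₀ t = (z_t − 1)∕((z_t + 1)η)`).
This file proves `∃ N₁ E, hE ∧ hΔ` at EVERY ramified non-split place — no `|2|_w = 1`, no residue signs (the wild∕uniform twin of ★ p843873):
**`exists_rankOneDelta_mul_symbol_eq_of_ramified`**, for an ABSTRACT Cayley-parameter function `b₀` with its spec `hb₀` on the deep regular locus (so that the
bookkeeping socket (Ψ4-book) reads the same `ε`), plus **`exists_cayleyParameter_of_skew`** supplying one such `b₀`.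

Proof: ★ ED. 1 `…_of_skew` gives `μ_v(a_t)⁻¹ = μ_v(τ₁ t)⁻¹ C⁻¹ ε t` once `|a_t|_w ≤ |2 ι_w ϖ_v^{M₀}|_w`; `ε t² = 1`; `√∏ = √(q^{log|a_t|_w})` (★ `sqrt_prod_norm_eq_sqrt_zpow_log_of_ramified`).
PARITY IS FIXED BY `η` on the deep locus: for `N t > ord_w 2 =: d₂` (even, `= 2 ord_v 2`), `|z_t + 1| = |2|_w`, so `|ι_w b₀ t|_w = exp(−N t + d₂ − log|η|)` is a square
(`= |b₀ t|_v²`), whence `N t ≡ log|η|_w (mod 2)`: if `log|η|` is odd, `N t = 2r+1`, `√∏ = q^{−r}(√q)⁻¹`, `E t = μ_v(τ₁ t)⁻¹ (C√q)⁻¹`; if even, `N t = 2r`,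
`√∏ = q^{−r}`, `(N t − 1)∕2 = r − 1`, `E t = μ_v(τ₁ t)⁻¹ (Cq)⁻¹`.  `hE` is ★ `inv_finHeckeValue_frameEntry_mul_eventually_eq`.
[cite: Rogawski1990, §4.9 Lemma 4.9.3 (4.9.2) p. 56] [cite: LabesseLanglands1979, §2 (2.1)–(2.2), p. 9] [cite: Serre1979, Ch. XIV §3]
-/

open NumberField IsDedekindDomain Filter Topology ValuativeRel
open scoped ValuativeRel
open scoped MatrixGroups

open Literature.NumberTheory.Automorphic Literature.NumberTheory.Automorphic.UnitaryGroup Literature.NumberTheory.GaloisRepresentations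
open Literature.NumberTheory.QuadraticForms

namespace Literature.NumberTheory.Rogawski1990

section Uniform

variable (L : Type) [Field L] [NumberField L] [IsCMField L] (v : HeightOneSpectrum (𝓞 ↥(maximalRealSubfield L)))

/-- in `ℤₘ₀`: `x ^ 2 = y ^ 2 ⇒ x = y`. [folklore] -/
private theorem eq_of_sq_eq_sq₁₆ {x y : WithZero (Multiplicative ℤ)} (h : x ^ 2 = y ^ 2) : x = y := by
  rcases lt_trichotomy x y with hxy | hxy | hxy
  · exact absurd h (pow_lt_pow_left₀ hxy zero_le two_ne_zero).ne
  · exact hxy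
  · exact absurd h (pow_lt_pow_left₀ hxy zero_le two_ne_zero).ne'

/-- `((a,b) : ℂ)·((a,b) : ℂ) = 1` for a Hilbert symbol (`±1`). [cite: Serre1979, Ch. XIV §3] -/
private theorem hilbertSymbol_cast_mul_self₁₆ {F : Type*} [Field F] (a b : F) :
    ((hilbertSymbol F a b : ℤ) : ℂ) * ((hilbertSymbol F a b : ℤ) : ℂ) = 1 := by
  unfold hilbertSymbol
  split_ifs <;> norm_num

/-- `√(x^{−2r}) = (x^r)⁻¹` for `x ≥ 0`. [folklore] -/
private theorem sqrt_zpow_neg_two_mul₁₆ {x : ℝ} (hx : 0 ≤ x) (r : ℕ) : Real.sqrt (x ^ (-(2 * (r : ℤ)))) = (x ^ r)⁻¹ := by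
  rw [show (-(2 * (r : ℤ))) = -(((r * 2 : ℕ) : ℤ)) by push_cast; ring, zpow_neg, zpow_natCast, Real.sqrt_inv, pow_mul, Real.sqrt_sq (pow_nonneg hx r)]

/-- `(2 : L_w) ≠ 0`, `|2|_w = exp(−d₂)` with `d₂ := (−log|2|_w).toNat`, and `d₂` is EVEN at a non-split place with `e(w|v) = 2` (`|ι_w 2|_w = |2|_v²`). [cite: Serre1979, Ch. III §6] -/
private theorem valued_two_eq_exp_neg₁₆ (w : PlacesOver L v) (hw : IsCMField.complexConj L • w.1 = w.1) (he : v.asIdeal.ramificationIdx' w.1.asIdeal ≠ 1) :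
    (2 : w.1.adicCompletion L) ≠ 0 ∧
      Valued.v (2 : w.1.adicCompletion L) = WithZero.exp (-((-WithZero.log (Valued.v (2 : w.1.adicCompletion L))).toNat : ℤ)) ∧
      ∃ m₂ : ℤ, ((-WithZero.log (Valued.v (2 : w.1.adicCompletion L))).toNat : ℤ) = 2 * m₂ := by
  have hc1 : IsCMField.complexConj L ≠ 1 := IsCMField.complexConj_ne_one L
  haveI := PlacesOver.liesOver (E := L) w
  have he2 : v.asIdeal.ramificationIdx' w.1.asIdeal = 2 := Liu2021.LemD1IndexedNonVacuityRamifiedPlace.ramificationIdx'_eq_two_of_ne_one L v (IsCMField.complexConj L) hc1 w hw he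
  have h20 : (2 : w.1.adicCompletion L) ≠ 0 := by
    rw [show (2 : w.1.adicCompletion L) = algebraMap L (w.1.adicCompletion L) 2 from (map_ofNat _ 2).symm]
    exact (map_ne_zero_iff _ (algebraMap L (w.1.adicCompletion L)).injective).2 two_ne_zero
  have hv0 : Valued.v (2 : w.1.adicCompletion L) ≠ 0 := (Valuation.ne_zero_iff _).2 h20
  have hle : Valued.v (2 : w.1.adicCompletion L) ≤ 1 := by
    calc Valued.v (2 : w.1.adicCompletion L) = Valued.v ((1 : w.1.adicCompletion L) + 1) := by norm_num
      _ ≤ max (Valued.v (1 : w.1.adicCompletion L)) (Valued.v (1 : w.1.adicCompletion L)) := Valuation.map_add _ _ _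
      _ = 1 := by simp
  have hlogle : WithZero.log (Valued.v (2 : w.1.adicCompletion L)) ≤ 0 := by
    have h := (WithZero.log_le_log hv0 one_ne_zero).2 hle
    rwa [WithZero.log_one] at h
  refine ⟨h20, by rw [Int.toNat_of_nonneg (by linarith), neg_neg, WithZero.exp_log hv0], ?_⟩
  -- evenness: `|2|_w = |ι_w 2|_w = |2|_v ^ 2`
  have h2v0 : Valued.v (2 : v.adicCompletion ↥(maximalRealSubfield L)) ≠ 0 := by
    intro h0
    apply hv0
    rw [show (2 : w.1.adicCompletion L) = toPlace v w 2 from (map_ofNat _ 2).symm, valued_toPlace, h0, he2, zero_pow two_ne_zero]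
  refine ⟨-WithZero.log (Valued.v (2 : v.adicCompletion ↥(maximalRealSubfield L))), ?_⟩
  rw [Int.toNat_of_nonneg (by linarith)]
  have h : Valued.v (2 : w.1.adicCompletion L) = Valued.v (2 : v.adicCompletion ↥(maximalRealSubfield L)) ^ 2 := by
    rw [show (2 : w.1.adicCompletion L) = toPlace v w 2 from (map_ofNat _ 2).symm, valued_toPlace, he2]
  rw [← WithZero.exp_log hv0, ← WithZero.exp_log h2v0, ← WithZero.exp_nsmul, WithZero.exp_inj, nsmul_eq_mul] at h
  push_cast at h
  linarith

set_option maxHeartbeats 800000 in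
/-- **(Ψ4-Δ) — `Δ` ALONG THE ELLIPTIC TORUS AT A RAMIFIED PLACE, UNIFORM IN THE RESIDUE CHARACTERISTIC (no `|2|_w = 1`), IN THE (γ) LAYER'S `hE ∧ hΔ` SHAPE.**
Data: a ramified non-split `w ∣ v`, `μ` under print's guard, an elliptic regular frame `(t₀, P, d)`, a skew `η ∈ L_w` (`σ_w η = −η`, `η ≠ 0`) and a Cayley-parameter function `b₀` on
`Z(t₀)` with its spec on the deep regular locus (`ι_w b₀ t = (z_t − 1)∕((z_t + 1)η)`, `z_t = (τ₀ t)_w∕(τ₁ t)_w`; ★ `exists_cayleyParameter_of_skew` supplies one).  THEN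
`∃ N₁ E`, `E` eventually constant at every singular point of the torus along the regular locus, and for every regular `t` with `N t ≥ N₁`:
**`μ_v(τ₀ t − τ₁ t)⁻¹ · √(∏‖τ₀ t − τ₁ t‖) · ((b₀ t, θ)_v : ℂ) = E t · ((q : ℂ) ^ ((N t − 1) ∕ 2))⁻¹`**, `q = #(𝓞_{L⁺}∕v)`, `θ` the CM generator — the (γ) layer's
binders `hE`, `hΔ` token for token at `ε := fun t ↦ ((b₀ t, θ)_v : ℂ)`.  `E t = μ_v(τ₁ t)⁻¹ · (C√q)⁻¹` or `μ_v(τ₁ t)⁻¹ · (Cq)⁻¹` according as `log|η|_w` is odd or even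
(the parity of `N t` on the deep locus).  [cite: Rogawski1990, §4.9 Lemma 4.9.3 (4.9.2) p. 56] [cite: LabesseLanglands1979, §2 (2.1)–(2.2), p. 9] -/
theorem exists_rankOneDelta_mul_symbol_eq_of_ramified (w : PlacesOver L v) (hw : IsCMField.complexConj L • w.1 = w.1)
    (he : v.asIdeal.ramificationIdx' w.1.asIdeal ≠ 1) (μ : HeckeCharacter L)
    (hμω : ∀ x : ideleGroup ↥(maximalRealSubfield L), μ (AdeleRing.ideleBaseChange ↥(maximalRealSubfield L) L x) = quadraticHeckeCharCM L x)
    (t₀ : ((cmDatum L 2 (Matrix.of fun i j : Fin 2 => if i.val + j.val + 1 = 2 then (1 : L) else 0)).Local v × (cmDatum L 1 (Matrix.of fun i j : Fin 1 => if i.val + j.val + 1 = 1 then (1 : L) else 0)).Local v)) (P : GL (Fin 2) (LocalRing L v)) (d : Fin 2 → (LocalRing L v)) (ht₀ : IsRegularElt (t₀.1.val : GL (Fin 2) (LocalRing L v)))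
    (hP : (t₀.1.val.val : Matrix (Fin 2) (Fin 2) (LocalRing L v)) * P.val = P.val * Matrix.diagonal d) (hd1 : ∀ i, conjLocal L (IsCMField.complexConj L) v (d i) * d i = 1)
    {η : (w.1.adicCompletion L)} (hση : (galAdicCompletionMap (L := L) (IsCMField.complexConj L) hw) η = -η) (hη0 : η ≠ 0) (b₀ : ↥(Subgroup.centralizer ({t₀} : Set ((cmDatum L 2 (Matrix.of fun i j : Fin 2 => if i.val + j.val + 1 = 2 then (1 : L) else 0)).Local v × (cmDatum L 1 (Matrix.of fun i j : Fin 1 => if i.val + j.val + 1 = 1 then (1 : L) else 0)).Local v))) → (v.adicCompletion ↥(maximalRealSubfield L))ˣ) (N₀ : ℕ)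
    (hb₀ : ∀ t : ↥(Subgroup.centralizer ({t₀} : Set ((cmDatum L 2 (Matrix.of fun i j : Fin 2 => if i.val + j.val + 1 = 2 then (1 : L) else 0)).Local v × (cmDatum L 1 (Matrix.of fun i j : Fin 1 => if i.val + j.val + 1 = 1 then (1 : L) else 0)).Local v))), IsRegularElt ((t : ((cmDatum L 2 (Matrix.of fun i j : Fin 2 => if i.val + j.val + 1 = 2 then (1 : L) else 0)).Local v × (cmDatum L 1 (Matrix.of fun i j : Fin 1 => if i.val + j.val + 1 = 1 then (1 : L) else 0)).Local v)).1.val : GL (Fin 2) (LocalRing L v)) → N₀ ≤ (-WithZero.log (Valued.v ((((P⁻¹).val * ((t : ((cmDatum L 2 (Matrix.of fun i j : Fin 2 => if i.val + j.val + 1 = 2 then (1 : L) else 0)).Local v × (cmDatum L 1 (Matrix.of fun i j : Fin 1 => if i.val + j.val + 1 = 1 then (1 : L) else 0)).Local v)).1.val.val : Matrix (Fin 2) (Fin 2) (LocalRing L v)) * P.val) 0 0 - ((P⁻¹).val * ((t : ((cmDatum L 2 (Matrix.of fun i j : Fin 2 => if i.val + j.val + 1 = 2 then (1 : L) else 0)).Local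 v × (cmDatum L 1 (Matrix.of fun i j : Fin 1 => if i.val + j.val + 1 = 1 then (1 : L) else 0)).Local v)).1.val.val : Matrix (Fin 2) (Fin 2) (LocalRing L v)) * P.val) 1 1) w))).toNat →
      toPlace v w ((b₀ t : (v.adicCompletion ↥(maximalRealSubfield L)))) = ((((P⁻¹).val * ((t : ((cmDatum L 2 (Matrix.of fun i j : Fin 2 => if i.val + j.val + 1 = 2 then (1 : L) else 0)).Local v × (cmDatum L 1 (Matrix.of fun i j : Fin 1 => if i.val + j.val + 1 = 1 then (1 : L) else 0)).Local v)).1.val.val : Matrix (Fin 2) (Fin 2) (LocalRing L v)) * P.val) 0 0) w / (((P⁻¹).val * ((t : ((cmDatum L 2 (Matrix.of fun i j : Fin 2 => if i.val + j.val + 1 = 2 then (1 : L) else 0)).Local v × (cmDatum L 1 (Matrix.of fun i j : Fin 1 => if i.val + j.val + 1 = 1 then (1 : L) else 0)).Local v)).1.val.val : Matrix (Fin 2) (Fin 2) (LocalRing L v)) * P.val) 1 1) w - 1) / (((((P⁻¹).val * ((t : ((cmDatum L 2 (Matrix.of fun i j : Fin 2 => if i.val + j.val + 1 = 2 then (1 :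 L) else 0)).Local v × (cmDatum L 1 (Matrix.of fun i j : Fin 1 => if i.val + j.val + 1 = 1 then (1 : L) else 0)).Local v)).1.val.val : Matrix (Fin 2) (Fin 2) (LocalRing L v)) * P.val) 0 0) w / (((P⁻¹).val * ((t : ((cmDatum L 2 (Matrix.of fun i j : Fin 2 => if i.val + j.val + 1 = 2 then (1 : L) else 0)).Local v × (cmDatum L 1 (Matrix.of fun i j : Fin 1 => if i.val + j.val + 1 = 1 then (1 : L) else 0)).Local v)).1.val.val : Matrix (Fin 2) (Fin 2) (LocalRing L v)) * P.val) 1 1) w + 1) * η)) :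
    ∃ (N₁ : ℕ) (E : ↥(Subgroup.centralizer ({t₀} : Set ((cmDatum L 2 (Matrix.of fun i j : Fin 2 => if i.val + j.val + 1 = 2 then (1 : L) else 0)).Local v × (cmDatum L 1 (Matrix.of fun i j : Fin 1 => if i.val + j.val + 1 = 1 then (1 : L) else 0)).Local v))) → ℂ),
      (∀ s : ↥(Subgroup.centralizer ({t₀} : Set ((cmDatum L 2 (Matrix.of fun i j : Fin 2 => if i.val + j.val + 1 = 2 then (1 : L) else 0)).Local v × (cmDatum L 1 (Matrix.of fun i j : Fin 1 => if i.val + j.val + 1 = 1 then (1 : L) else 0)).Local v))), ¬ IsRegularElt ((s : ((cmDatum L 2 (Matrix.of fun i j : Fin 2 => if i.val + j.val + 1 = 2 then (1 : L) else 0)).Local v × (cmDatum L 1 (Matrix.of fun i j : Fin 1 => if i.val + j.val + 1 = 1 then (1 : L) else 0)).Local v)).1.val : GL (Fin 2) (LocalRing L v)) →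
        ∀ᶠ (t : ↥(Subgroup.centralizer ({t₀} : Set ((cmDatum L 2 (Matrix.of fun i j : Fin 2 => if i.val + j.val + 1 = 2 then (1 : L) else 0)).Local v × (cmDatum L 1 (Matrix.of fun i j : Fin 1 => if i.val + j.val + 1 = 1 then (1 : L) else 0)).Local v)))) in 𝓝 s, t ∈ {t : ↥(Subgroup.centralizer ({t₀} : Set ((cmDatum L 2 (Matrix.of fun i j : Fin 2 => if i.val + j.val + 1 = 2 then (1 : L) else 0)).Local v × (cmDatum L 1 (Matrix.of fun i j : Fin 1 => if i.val + j.val + 1 = 1 then (1 : L) else 0)).Local v))) | IsRegularElt ((t : ((cmDatum L 2 (Matrix.of fun i j : Fin 2 => if i.val + j.val + 1 = 2 then (1 : L) else 0)).Local v × (cmDatum L 1 (Matrix.of fun i j : Fin 1 => if i.val + j.val + 1 = 1 then (1 : L) else 0)).Local v)).1.val : GL (Fin 2) (LocalRing L v))} → E t = E s) ∧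
      ∀ t : ↥(Subgroup.centralizer ({t₀} : Set ((cmDatum L 2 (Matrix.of fun i j : Fin 2 => if i.val + j.val + 1 = 2 then (1 : L) else 0)).Local v × (cmDatum L 1 (Matrix.of fun i j : Fin 1 => if i.val + j.val + 1 = 1 then (1 : L) else 0)).Local v))), t ∈ {t : ↥(Subgroup.centralizer ({t₀} : Set ((cmDatum L 2 (Matrix.of fun i j : Fin 2 => if i.val + j.val + 1 = 2 then (1 : L) else 0)).Local v × (cmDatum L 1 (Matrix.of fun i j : Fin 1 => if i.val + j.val + 1 = 1 then (1 : L) else 0)).Local v))) | IsRegularElt ((t : ((cmDatum L 2 (Matrix.of fun i j : Fin 2 => if i.val + j.val + 1 = 2 then (1 : L) else 0)).Local v × (cmDatum L 1 (Matrix.of fun i j : Fin 1 => if i.val + j.val + 1 = 1 then (1 : L) else 0)).Local v)).1.val : GL (Fin 2) (LocalRing L v))} →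
        N₁ ≤ (-WithZero.log (Valued.v ((((P⁻¹).val * ((t : ((cmDatum L 2 (Matrix.of fun i j : Fin 2 => if i.val + j.val + 1 = 2 then (1 : L) else 0)).Local v × (cmDatum L 1 (Matrix.of fun i j : Fin 1 => if i.val + j.val + 1 = 1 then (1 : L) else 0)).Local v)).1.val.val : Matrix (Fin 2) (Fin 2) (LocalRing L v)) * P.val) 0 0 - ((P⁻¹).val * ((t : ((cmDatum L 2 (Matrix.of fun i j : Fin 2 => if i.val + j.val + 1 = 2 then (1 : L) else 0)).Local v × (cmDatum L 1 (Matrix.of fun i j : Fin 1 => if i.val + j.val + 1 = 1 then (1 : L) else 0)).Local v)).1.val.val : Matrix (Fin 2) (Fin 2) (LocalRing L v)) * P.val) 1 1) w))).toNat →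
        ((finHeckeValue L v μ (((P⁻¹).val * ((t : ((cmDatum L 2 (Matrix.of fun i j : Fin 2 => if i.val + j.val + 1 = 2 then (1 : L) else 0)).Local v × (cmDatum L 1 (Matrix.of fun i j : Fin 1 => if i.val + j.val + 1 = 1 then (1 : L) else 0)).Local v)).1.val.val : Matrix (Fin 2) (Fin 2) (LocalRing L v)) * P.val) 0 0 - ((P⁻¹).val * ((t : ((cmDatum L 2 (Matrix.of fun i j : Fin 2 => if i.val + j.val + 1 = 2 then (1 : L) else 0)).Local v × (cmDatum L 1 (Matrix.of fun i j : Fin 1 => if i.val + j.val + 1 = 1 then (1 : L) else 0)).Local v)).1.val.val : Matrix (Fin 2) (Fin 2) (LocalRing L v)) * P.val) 1 1))⁻¹ : ℂ) * ((Real.sqrt (∏ w' : PlacesOver L v, ‖(((P⁻¹).val * ((t : ((cmDatum L 2 (Matrix.of fun i j : Fin 2 => if i.val + j.val + 1 = 2 then (1 : L) else 0)).Local v × (cmDatum L 1 (Matrix.of fun i j : Fin 1 => if i.val + j.val + 1 = 1 then (1 : L) else 0)).Local v)).1.val.val : Matrix (Fin 2) (Fin 2) (LocalRing L v)) * P.val)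 0 0 - ((P⁻¹).val * ((t : ((cmDatum L 2 (Matrix.of fun i j : Fin 2 => if i.val + j.val + 1 = 2 then (1 : L) else 0)).Local v × (cmDatum L 1 (Matrix.of fun i j : Fin 1 => if i.val + j.val + 1 = 1 then (1 : L) else 0)).Local v)).1.val.val : Matrix (Fin 2) (Fin 2) (LocalRing L v)) * P.val) 1 1) w'‖) : ℝ) : ℂ) *
            ((hilbertSymbol (v.adicCompletion ↥(maximalRealSubfield L)) ((b₀ t : (v.adicCompletion ↥(maximalRealSubfield L))))
              (algebraMap ↥(maximalRealSubfield L) (v.adicCompletion ↥(maximalRealSubfield L)) ((cmQuadraticGenerator L : 𝓞 ↥(maximalRealSubfield L)) : ↥(maximalRealSubfield L))) : ℤ) : ℂ) =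
          E t * (((Nat.card (𝓞 ↥(maximalRealSubfield L) ⧸ v.asIdeal) : ℂ)) ^ (((-WithZero.log (Valued.v ((((P⁻¹).val * ((t : ((cmDatum L 2 (Matrix.of fun i j : Fin 2 => if i.val + j.val + 1 = 2 then (1 : L) else 0)).Local v × (cmDatum L 1 (Matrix.of fun i j : Fin 1 => if i.val + j.val + 1 = 1 then (1 : L) else 0)).Local v)).1.val.val : Matrix (Fin 2) (Fin 2) (LocalRing L v)) * P.val) 0 0 - ((P⁻¹).val * ((t : ((cmDatum L 2 (Matrix.of fun i j : Fin 2 => if i.val + j.val + 1 = 2 then (1 : L) else 0)).Local v × (cmDatum L 1 (Matrix.of fun i j : Fin 1 => if i.val + j.val + 1 = 1 then (1 : L) else 0)).Local v)).1.val.val : Matrix (Fin 2) (Fin 2) (LocalRing L v)) * P.val) 1 1) w))).toNat - 1) / 2))⁻¹ := by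
  classical
  have hc1 : IsCMField.complexConj L ≠ 1 := IsCMField.complexConj_ne_one L
  haveI hv : Subsingleton (PlacesOver L v) := PlacesOver.subsingleton_of_smul_eq (IsCMField.complexConj L) hc1 w hw
  haveI := PlacesOver.liesOver (E := L) w
  have he2 : v.asIdeal.ramificationIdx' w.1.asIdeal = 2 := Liu2021.LemD1IndexedNonVacuityRamifiedPlace.ramificationIdx'_eq_two_of_ne_one L v (IsCMField.complexConj L) hc1 w hw he
  -- `|2|_w = exp(−d₂)`, `d₂` even
  obtain ⟨h20, h2v, m₂, hd₂⟩ := valued_two_eq_exp_neg₁₆ L v w hw he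
  set d₂ : ℕ := (-WithZero.log (Valued.v (2 : (w.1.adicCompletion L)))).toNat with hd₂def
  -- `|η| = exp(m_η)`
  have hηv0 : Valued.v η ≠ 0 := (Valuation.ne_zero_iff _).2 hη0
  set mη : ℤ := WithZero.log (Valued.v η) with hmηdef
  have hηv : Valued.v η = WithZero.exp mη := by rw [hmηdef, WithZero.exp_log hηv0]
  -- ED. 1 at the skew `η`
  obtain ⟨M₀, C, hM₁, hC0, hcore⟩ := exists_finHeckeValue_sub_inv_eq_mul_hilbertSymbol_of_skew L v w hw μ hμω hση hη0
  have hq0 : 0 < Nat.card (𝓞 ↥(maximalRealSubfield L) ⧸ v.asIdeal) := Nat.card_pos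
  -- the constant: `(C·√q)⁻¹` if `m_η` odd, `(C·q)⁻¹` if even
  obtain ⟨K, hK⟩ : ∃ K : ℂ, K = if Odd mη then C * ((Real.sqrt (Nat.card (𝓞 ↥(maximalRealSubfield L) ⧸ v.asIdeal) : ℝ) : ℝ) : ℂ)
      else C * (Nat.card (𝓞 ↥(maximalRealSubfield L) ⧸ v.asIdeal) : ℂ) := ⟨_, rfl⟩
  refine ⟨2 * M₀ + d₂ + N₀ + 1, fun t => (finHeckeValue L v μ (((P⁻¹).val * ((t : ((cmDatum L 2 (Matrix.of fun i j : Fin 2 => if i.val + j.val + 1 = 2 then (1 : L) else 0)).Local v × (cmDatum L 1 (Matrix.of fun i j : Fin 1 => if i.val + j.val + 1 = 1 then (1 : L) else 0)).Local v)).1.val.val : Matrix (Fin 2) (Fin 2) (LocalRing L v)) * P.val) 1 1))⁻¹ * K⁻¹, fun s _ => ?_, fun t ht hN => ?_⟩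
  · exact (inv_finHeckeValue_frameEntry_mul_eventually_eq L v w hw t₀ P d ht₀ hP hd1 μ K 1 s).mono fun t h _ => h
  -- the torus point
  simp only [Set.mem_setOf_eq] at ht
  beta_reduce
  obtain ⟨hn1, hPt⟩ := normOne_frame_of_mem_centralizer L v w hw t₀ P d ht₀ hP hd1 _ t.2
  have hb₀t := hb₀ t ht (le_trans (by omega) hN)
  clear hb₀
  set a : LocalRing L v := ((P⁻¹).val * ((t : ((cmDatum L 2 (Matrix.of fun i j : Fin 2 => if i.val + j.val + 1 = 2 then (1 : L) else 0)).Local v × (cmDatum L 1 (Matrix.of fun i j : Fin 1 => if i.val + j.val + 1 = 1 then (1 : L) else 0)).Local v)).1.val.val : Matrix (Fin 2) (Fin 2) (LocalRing L v)) * P.val) 0 0 with hadef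
  set c : LocalRing L v := ((P⁻¹).val * ((t : ((cmDatum L 2 (Matrix.of fun i j : Fin 2 => if i.val + j.val + 1 = 2 then (1 : L) else 0)).Local v × (cmDatum L 1 (Matrix.of fun i j : Fin 1 => if i.val + j.val + 1 = 1 then (1 : L) else 0)).Local v)).1.val.val : Matrix (Fin 2) (Fin 2) (LocalRing L v)) * P.val) 1 1 with hcdef
  have hxu : IsUnit (a - c) := isUnit_frameDiff_of_isRegularElt L v w hw t₀ P d ht₀ hP hd1 t ht
  have hx0 : (a - c) w ≠ 0 := (hxu.map (Pi.evalRingHom (fun w' : PlacesOver L v => w'.1.adicCompletion L) w)).ne_zero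
  have hva : Valued.v (a w) = 1 := valued_apply_eq_one_of_conjLocal_mul_self L v w hw (hn1 0)
  have hvc : Valued.v (c w) = 1 := valued_apply_eq_one_of_conjLocal_mul_self L v w hw (hn1 1)
  have hc0 : c w ≠ 0 := fun h0 => by rw [h0, map_zero] at hvc; exact zero_ne_one hvc
  -- the depth `N` and `|a_w − c_w| = exp(−N)`
  set N : ℕ := (-WithZero.log (Valued.v ((a - c) w))).toNat with hNdef
  have hvx0 : Valued.v ((a - c) w) ≠ 0 := (Valuation.ne_zero_iff _).2 hx0
  have hvxle : Valued.v ((a - c) w) ≤ 1 := by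
    rw [Pi.sub_apply]
    exact (Valuation.map_sub_le _ hva.le hvc.le)
  have hlogle : WithZero.log (Valued.v ((a - c) w)) ≤ 0 := by
    rwa [← WithZero.log_one, WithZero.log_le_log hvx0 one_ne_zero]
  have hlogx : WithZero.log (Valued.v ((a - c) w)) = -(N : ℤ) := by
    rw [hNdef, Int.toNat_of_nonneg (by linarith), neg_neg]
  have hvx : Valued.v ((a - c) w) = WithZero.exp (-(N : ℤ)) := by
    rw [← hlogx, WithZero.exp_log hvx0]
  have hNd : d₂ + 1 ≤ N := le_trans (by omega) hN
  -- `z := a_w ∕ c_w`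
  have hσa : (galAdicCompletionMap (L := L) (IsCMField.complexConj L) hw) (a w) * a w = 1 := by
    have h := congrArg (fun f : LocalRing L v => f w) (hn1 0)
    simpa only [Pi.mul_apply, Pi.one_apply, conjLocal_apply_eq_galAdicCompletionMap L v w hw, Matrix.cons_val_zero] using h
  have hσc : (galAdicCompletionMap (L := L) (IsCMField.complexConj L) hw) (c w) * c w = 1 := by
    have h := congrArg (fun f : LocalRing L v => f w) (hn1 1)
    simpa only [Pi.mul_apply, Pi.one_apply, conjLocal_apply_eq_galAdicCompletionMap L v w hw, Matrix.cons_val_one, Matrix.head_cons,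
      Matrix.cons_val_fin_one] using h
  have hzsub : a w / c w - 1 = (a - c) w / c w := by rw [Pi.sub_apply]; field_simp
  have hvz1 : Valued.v (a w / c w - 1) = WithZero.exp (-(N : ℤ)) := by rw [hzsub, map_div₀, hvc, div_one, hvx]
  have hvz1lt : Valued.v (a w / c w - 1) < Valued.v (2 : (w.1.adicCompletion L)) := by
    rw [hvz1, h2v, WithZero.exp_lt_exp]; omega
  have hvzp : Valued.v (a w / c w + 1) = WithZero.exp (-(d₂ : ℤ)) := by
    have h : a w / c w + 1 = (a w / c w - 1) + 2 := by ring
    rw [h, Valuation.map_add_eq_of_lt_right _ hvz1lt, h2v]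
  -- depth: `|a_w − c_w| ≤ |2 ι_w ϖ_v^{M₀}|`
  have hdeep : Valued.v (a w - c w) ≤
      Valued.v (2 * (toPlace v w (HeckeCharacter.uniformizer ↥(maximalRealSubfield L) v : v.adicCompletion ↥(maximalRealSubfield L))) ^ M₀) := by
    rw [← Pi.sub_apply, hvx, map_mul, h2v, map_pow, (valued_toPlace_uniformizer_of_ramified L (IsCMField.complexConj L) hc1 w hw he).1,
      ← WithZero.exp_nsmul, nsmul_eq_mul, ← WithZero.exp_add, WithZero.exp_le_exp]
    omega
  have hA := hcore a c (b₀ t) (hn1 1) hdeep hb₀t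
  -- valuation of `b₀ t`: `|ι_w b₀ t| = exp(−N + d₂ − m_η) = |b₀ t|_v²`, so `N ≡ m_η (mod 2)`
  have hvb0 : Valued.v (b₀ t : v.adicCompletion ↥(maximalRealSubfield L)) ≠ 0 := (Valuation.ne_zero_iff _).2 (b₀ t).ne_zero
  have hvιb : Valued.v (toPlace v w (b₀ t : v.adicCompletion ↥(maximalRealSubfield L))) = WithZero.exp (-(N : ℤ) + d₂ - mη) := by
    rw [hb₀t, map_div₀, map_mul, hvz1, hvzp, hηv, ← WithZero.exp_add, ← WithZero.exp_sub]
    congr 1; ring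
  have hpar : ∃ mb : ℤ, 2 * mb = -(N : ℤ) + d₂ - mη := by
    refine ⟨WithZero.log (Valued.v (b₀ t : v.adicCompletion ↥(maximalRealSubfield L))), ?_⟩
    have h := hvιb
    rw [valued_toPlace, he2, ← WithZero.exp_log hvb0, ← WithZero.exp_nsmul, WithZero.exp_inj, nsmul_eq_mul] at h
    push_cast at h
    linarith
  obtain ⟨mb, hmb⟩ := hpar
  -- `ε t² = 1`
  have hεε := hilbertSymbol_cast_mul_self₁₆ (b₀ t : v.adicCompletion ↥(maximalRealSubfield L))
    (algebraMap ↥(maximalRealSubfield L) (v.adicCompletion ↥(maximalRealSubfield L)) ((cmQuadraticGenerator L : 𝓞 ↥(maximalRealSubfield L)) : ↥(maximalRealSubfield L)))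
  -- `√∏ = √(q ^ log|a_t|_w)`
  have hsqrt := sqrt_prod_norm_eq_sqrt_zpow_log_of_ramified L v w hw he (x := a - c) hx0
  have hqpos : (0 : ℝ) < (Nat.card (𝓞 ↥(maximalRealSubfield L) ⧸ v.asIdeal) : ℝ) := by exact_mod_cast hq0
  have hqC : ((Nat.card (𝓞 ↥(maximalRealSubfield L) ⧸ v.asIdeal) : ℂ)) ≠ 0 := by exact_mod_cast hq0.ne'
  have hsqC : ((Real.sqrt (Nat.card (𝓞 ↥(maximalRealSubfield L) ⧸ v.asIdeal) : ℝ) : ℝ) : ℂ) ≠ 0 := by exact_mod_cast (Real.sqrt_pos.2 hqpos).ne'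
  -- reshape the LHS: `μ(a−c)⁻¹ · √∏ · ε = μ(c)⁻¹ · C⁻¹ · √∏` (`ε² = 1`)
  have hLHS : ((finHeckeValue L v μ (a - c))⁻¹ : ℂ) * ((Real.sqrt (∏ w' : PlacesOver L v, ‖(a - c) w'‖) : ℝ) : ℂ) *
      ((hilbertSymbol (v.adicCompletion ↥(maximalRealSubfield L)) ((b₀ t : (v.adicCompletion ↥(maximalRealSubfield L))))
        (algebraMap ↥(maximalRealSubfield L) (v.adicCompletion ↥(maximalRealSubfield L)) ((cmQuadraticGenerator L : 𝓞 ↥(maximalRealSubfield L)) : ↥(maximalRealSubfield L))) : ℤ) : ℂ) =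
      (finHeckeValue L v μ c)⁻¹ * C⁻¹ * ((Real.sqrt (∏ w' : PlacesOver L v, ‖(a - c) w'‖) : ℝ) : ℂ) := by
    rw [hA]
    linear_combination ((finHeckeValue L v μ c)⁻¹ * C⁻¹ * ((Real.sqrt (∏ w' : PlacesOver L v, ‖(a - c) w'‖) : ℝ) : ℂ)) * hεε
  rw [hLHS, hsqrt, hlogx]
  rcases Int.even_or_odd mη with ⟨j, hj⟩ | ⟨j, hj⟩
  · -- `m_η` even ⇒ `N = 2r`, `r ≥ 1`, `(N − 1)∕2 = r − 1`
    have hKe : K = C * (Nat.card (𝓞 ↥(maximalRealSubfield L) ⧸ v.asIdeal) : ℂ) := by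
      rw [hK, if_neg (Int.not_odd_iff_even.2 ⟨j, hj⟩)]
    obtain ⟨r, hr⟩ : ∃ r : ℕ, (N : ℤ) = 2 * r := ⟨(mb - m₂ + j).natAbs, by omega⟩
    have hr1 : 1 ≤ r := by omega
    have hNr : (N - 1) / 2 = r - 1 := by omega
    rw [hNr, hKe, show (-(N : ℤ)) = -(2 * (r : ℤ)) by omega, sqrt_zpow_neg_two_mul₁₆ hqpos.le r]
    push_cast
    rw [show r = (r - 1) + 1 from by omega, pow_succ]
    simp only [Nat.add_sub_cancel]
    field_simp
  · -- `m_η` odd ⇒ `N = 2r + 1`, `(N − 1)∕2 = r`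
    have hKo : K = C * ((Real.sqrt (Nat.card (𝓞 ↥(maximalRealSubfield L) ⧸ v.asIdeal) : ℝ) : ℝ) : ℂ) := by
      rw [hK, if_pos ⟨j, hj⟩]
    obtain ⟨r, hr⟩ : ∃ r : ℕ, (N : ℤ) = 2 * r + 1 := ⟨(mb - m₂ + j + 1).natAbs, by omega⟩
    have hNr : (N - 1) / 2 = r := by omega
    have hlog' : WithZero.log (Valued.v ((a - c) w)) = -((2 * r + 1 : ℕ) : ℤ) := by rw [hlogx]; push_cast; omega
    rw [hNr, hKo, ← hlogx, ← sqrt_prod_norm_eq_sqrt_zpow_log_of_ramified L v w hw he (x := a - c) hx0,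
      sqrt_prod_norm_eq_of_log_eq_neg_odd L v w hw he (x := a - c) hx0 hlog']
    push_cast
    field_simp

/-- **A CAYLEY-PARAMETER FUNCTION ON THE TORUS.**  For a skew `η ∈ L_w` (`σ_w η = −η`, `η ≠ 0`) there is `b₀ : Z(t₀) → (L⁺_v)ˣ` with
`ι_w (b₀ t) = (z_t − 1)∕((z_t + 1)·η)`, `z_t = (τ₀ t)_w ∕ (τ₁ t)_w`, at every regular `t` of depth `N t > ord_w 2` (then `z_t ≠ ±1`; ★ `exists_units_toPlace_eq_cayley_div`
pointwise, and choice). [cite: LabesseLanglands1979, §2 p. 9] [cite: Rogawski1990, §4.9 p. 56] -/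
theorem exists_cayleyParameter_of_skew (w : PlacesOver L v) (hw : IsCMField.complexConj L • w.1 = w.1)
    (he : v.asIdeal.ramificationIdx' w.1.asIdeal ≠ 1)
    (t₀ : ((cmDatum L 2 (Matrix.of fun i j : Fin 2 => if i.val + j.val + 1 = 2 then (1 : L) else 0)).Local v × (cmDatum L 1 (Matrix.of fun i j : Fin 1 => if i.val + j.val + 1 = 1 then (1 : L) else 0)).Local v)) (P : GL (Fin 2) (LocalRing L v)) (d : Fin 2 → (LocalRing L v)) (ht₀ : IsRegularElt (t₀.1.val : GL (Fin 2) (LocalRing L v)))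
    (hP : (t₀.1.val.val : Matrix (Fin 2) (Fin 2) (LocalRing L v)) * P.val = P.val * Matrix.diagonal d) (hd1 : ∀ i, conjLocal L (IsCMField.complexConj L) v (d i) * d i = 1)
    {η : (w.1.adicCompletion L)} (hση : (galAdicCompletionMap (L := L) (IsCMField.complexConj L) hw) η = -η) (hη0 : η ≠ 0) :
    ∃ b₀ : ↥(Subgroup.centralizer ({t₀} : Set ((cmDatum L 2 (Matrix.of fun i j : Fin 2 => if i.val + j.val + 1 = 2 then (1 : L) else 0)).Local v × (cmDatum L 1 (Matrix.of fun i j : Fin 1 => if i.val + j.val + 1 = 1 then (1 : L) else 0)).Local v))) → (v.adicCompletion ↥(maximalRealSubfield L))ˣ,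
      ∀ t : ↥(Subgroup.centralizer ({t₀} : Set ((cmDatum L 2 (Matrix.of fun i j : Fin 2 => if i.val + j.val + 1 = 2 then (1 : L) else 0)).Local v × (cmDatum L 1 (Matrix.of fun i j : Fin 1 => if i.val + j.val + 1 = 1 then (1 : L) else 0)).Local v))), IsRegularElt ((t : ((cmDatum L 2 (Matrix.of fun i j : Fin 2 => if i.val + j.val + 1 = 2 then (1 : L) else 0)).Local v × (cmDatum L 1 (Matrix.of fun i j : Fin 1 => if i.val + j.val + 1 = 1 then (1 : L) else 0)).Local v)).1.val : GL (Fin 2) (LocalRing L v)) →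
        (-WithZero.log (Valued.v (2 : (w.1.adicCompletion L)))).toNat + 1 ≤ (-WithZero.log (Valued.v ((((P⁻¹).val * ((t : ((cmDatum L 2 (Matrix.of fun i j : Fin 2 => if i.val + j.val + 1 = 2 then (1 : L) else 0)).Local v × (cmDatum L 1 (Matrix.of fun i j : Fin 1 => if i.val + j.val + 1 = 1 then (1 : L) else 0)).Local v)).1.val.val : Matrix (Fin 2) (Fin 2) (LocalRing L v)) * P.val) 0 0 - ((P⁻¹).val * ((t : ((cmDatum L 2 (Matrix.of fun i j : Fin 2 => if i.val + j.val + 1 = 2 then (1 : L) else 0)).Local v × (cmDatum L 1 (Matrix.of fun i j : Fin 1 => if i.val + j.val + 1 = 1 then (1 : L) else 0)).Local v)).1.val.val : Matrix (Fin 2) (Fin 2) (LocalRing L v)) * P.val) 1 1) w))).toNat →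
        toPlace v w ((b₀ t : (v.adicCompletion ↥(maximalRealSubfield L)))) = ((((P⁻¹).val * ((t : ((cmDatum L 2 (Matrix.of fun i j : Fin 2 => if i.val + j.val + 1 = 2 then (1 : L) else 0)).Local v × (cmDatum L 1 (Matrix.of fun i j : Fin 1 => if i.val + j.val + 1 = 1 then (1 : L) else 0)).Local v)).1.val.val : Matrix (Fin 2) (Fin 2) (LocalRing L v)) * P.val) 0 0) w / (((P⁻¹).val * ((t : ((cmDatum L 2 (Matrix.of fun i j : Fin 2 => if i.val + j.val + 1 = 2 then (1 : L) else 0)).Local v × (cmDatum L 1 (Matrix.of fun i j : Fin 1 => if i.val + j.val + 1 = 1 then (1 : L) else 0)).Local v)).1.val.val : Matrix (Fin 2) (Fin 2) (LocalRing L v)) * P.val) 1 1) w - 1) / (((((P⁻¹).val * ((t : ((cmDatum L 2 (Matrix.of fun i j : Fin 2 => if i.val + j.val + 1 = 2 then (1 : L) else 0)).Local v × (cmDatum L 1 (Matrix.of fun i j : Fin 1 => if i.val + j.val + 1 = 1 then (1 : L) else 0)).Local v)).1.val.val : Matrix (Fin 2) (Fin 2) (LocalRing L v)) * P.val) 0 0)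 w / (((P⁻¹).val * ((t : ((cmDatum L 2 (Matrix.of fun i j : Fin 2 => if i.val + j.val + 1 = 2 then (1 : L) else 0)).Local v × (cmDatum L 1 (Matrix.of fun i j : Fin 1 => if i.val + j.val + 1 = 1 then (1 : L) else 0)).Local v)).1.val.val : Matrix (Fin 2) (Fin 2) (LocalRing L v)) * P.val) 1 1) w + 1) * η) := by
  classical
  obtain ⟨h20, h2v, -⟩ := valued_two_eq_exp_neg₁₆ L v w hw he
  -- pointwise existence on the deep regular locus
  have hpt : ∀ t : ↥(Subgroup.centralizer ({t₀} : Set ((cmDatum L 2 (Matrix.of fun i j : Fin 2 => if i.val + j.val + 1 = 2 then (1 : L) else 0)).Local v × (cmDatum L 1 (Matrix.of fun i j : Fin 1 => if i.val + j.val + 1 = 1 then (1 : L) else 0)).Local v))), IsRegularElt ((t : ((cmDatum L 2 (Matrix.of fun i j : Fin 2 => if i.val + j.val + 1 = 2 then (1 : L) else 0)).Local v × (cmDatum L 1 (Matrix.of fun i j : Fin 1 => if i.val + j.val + 1 = 1 then (1 : L) else 0)).Local v)).1.val : GL (Fin 2) (LocalRing L v)) →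
      (-WithZero.log (Valued.v (2 : (w.1.adicCompletion L)))).toNat + 1 ≤ (-WithZero.log (Valued.v ((((P⁻¹).val * ((t : ((cmDatum L 2 (Matrix.of fun i j : Fin 2 => if i.val + j.val + 1 = 2 then (1 : L) else 0)).Local v × (cmDatum L 1 (Matrix.of fun i j : Fin 1 => if i.val + j.val + 1 = 1 then (1 : L) else 0)).Local v)).1.val.val : Matrix (Fin 2) (Fin 2) (LocalRing L v)) * P.val) 0 0 - ((P⁻¹).val * ((t : ((cmDatum L 2 (Matrix.of fun i j : Fin 2 => if i.val + j.val + 1 = 2 then (1 : L) else 0)).Local v × (cmDatum L 1 (Matrix.of fun i j : Fin 1 => if i.val + j.val + 1 = 1 then (1 : L) else 0)).Local v)).1.val.val : Matrix (Fin 2) (Fin 2) (LocalRing L v)) * P.val) 1 1) w))).toNat →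
      ∃ b : (v.adicCompletion ↥(maximalRealSubfield L))ˣ,
        toPlace v w ((b : (v.adicCompletion ↥(maximalRealSubfield L)))) = ((((P⁻¹).val * ((t : ((cmDatum L 2 (Matrix.of fun i j : Fin 2 => if i.val + j.val + 1 = 2 then (1 : L) else 0)).Local v × (cmDatum L 1 (Matrix.of fun i j : Fin 1 => if i.val + j.val + 1 = 1 then (1 : L) else 0)).Local v)).1.val.val : Matrix (Fin 2) (Fin 2) (LocalRing L v)) * P.val) 0 0) w / (((P⁻¹).val * ((t : ((cmDatum L 2 (Matrix.of fun i j : Fin 2 => if i.val + j.val + 1 = 2 then (1 : L) else 0)).Local v × (cmDatum L 1 (Matrix.of fun i j : Fin 1 => if i.val + j.val + 1 = 1 then (1 : L) else 0)).Local v)).1.val.val : Matrix (Fin 2) (Fin 2) (LocalRing L v)) * P.val) 1 1) w - 1) / (((((P⁻¹).val * ((t : ((cmDatum L 2 (Matrix.of fun i j : Fin 2 => if i.val + j.val + 1 = 2 then (1 : L) else 0)).Local v × (cmDatum L 1 (Matrix.of fun i j : Fin 1 => if i.val + j.val + 1 = 1 then (1 : L) else 0)).Local v)).1.val.val : Matrix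 (Fin 2) (Fin 2) (LocalRing L v)) * P.val) 0 0) w / (((P⁻¹).val * ((t : ((cmDatum L 2 (Matrix.of fun i j : Fin 2 => if i.val + j.val + 1 = 2 then (1 : L) else 0)).Local v × (cmDatum L 1 (Matrix.of fun i j : Fin 1 => if i.val + j.val + 1 = 1 then (1 : L) else 0)).Local v)).1.val.val : Matrix (Fin 2) (Fin 2) (LocalRing L v)) * P.val) 1 1) w + 1) * η) := by
    intro t ht hN
    obtain ⟨hn1, -⟩ := normOne_frame_of_mem_centralizer L v w hw t₀ P d ht₀ hP hd1 _ t.2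
    set a : LocalRing L v := ((P⁻¹).val * ((t : ((cmDatum L 2 (Matrix.of fun i j : Fin 2 => if i.val + j.val + 1 = 2 then (1 : L) else 0)).Local v × (cmDatum L 1 (Matrix.of fun i j : Fin 1 => if i.val + j.val + 1 = 1 then (1 : L) else 0)).Local v)).1.val.val : Matrix (Fin 2) (Fin 2) (LocalRing L v)) * P.val) 0 0 with hadef
    set c : LocalRing L v := ((P⁻¹).val * ((t : ((cmDatum L 2 (Matrix.of fun i j : Fin 2 => if i.val + j.val + 1 = 2 then (1 : L) else 0)).Local v × (cmDatum L 1 (Matrix.of fun i j : Fin 1 => if i.val + j.val + 1 = 1 then (1 : L) else 0)).Local v)).1.val.val : Matrix (Fin 2) (Fin 2) (LocalRing L v)) * P.val) 1 1 with hcdef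
    have hxu : IsUnit (a - c) := isUnit_frameDiff_of_isRegularElt L v w hw t₀ P d ht₀ hP hd1 t ht
    have hx0 : (a - c) w ≠ 0 := (hxu.map (Pi.evalRingHom (fun w' : PlacesOver L v => w'.1.adicCompletion L) w)).ne_zero
    have hva : Valued.v (a w) = 1 := valued_apply_eq_one_of_conjLocal_mul_self L v w hw (hn1 0)
    have hvc : Valued.v (c w) = 1 := valued_apply_eq_one_of_conjLocal_mul_self L v w hw (hn1 1)
    have hc0 : c w ≠ 0 := fun h0 => by rw [h0, map_zero] at hvc; exact zero_ne_one hvc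
    have hvx0 : Valued.v ((a - c) w) ≠ 0 := (Valuation.ne_zero_iff _).2 hx0
    have hvxle : Valued.v ((a - c) w) ≤ 1 := by
      rw [Pi.sub_apply]
      exact (Valuation.map_sub_le _ hva.le hvc.le)
    have hlogle : WithZero.log (Valued.v ((a - c) w)) ≤ 0 := by
      rwa [← WithZero.log_one, WithZero.log_le_log hvx0 one_ne_zero]
    have hvx : Valued.v ((a - c) w) = WithZero.exp (-((-WithZero.log (Valued.v ((a - c) w))).toNat : ℤ)) := by
      rw [Int.toNat_of_nonneg (by linarith), neg_neg, WithZero.exp_log hvx0]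
    have hσa : (galAdicCompletionMap (L := L) (IsCMField.complexConj L) hw) (a w) * a w = 1 := by
      have h := congrArg (fun f : LocalRing L v => f w) (hn1 0)
      simpa only [Pi.mul_apply, Pi.one_apply, conjLocal_apply_eq_galAdicCompletionMap L v w hw, Matrix.cons_val_zero] using h
    have hσc : (galAdicCompletionMap (L := L) (IsCMField.complexConj L) hw) (c w) * c w = 1 := by
      have h := congrArg (fun f : LocalRing L v => f w) (hn1 1)
      simpa only [Pi.mul_apply, Pi.one_apply, conjLocal_apply_eq_galAdicCompletionMap L v w hw, Matrix.cons_val_one, Matrix.head_cons,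
        Matrix.cons_val_fin_one] using h
    have hz : (galAdicCompletionMap (L := L) (IsCMField.complexConj L) hw) (a w / c w) * (a w / c w) = 1 := by
      rw [map_div₀, div_mul_div_comm, hσa, hσc, div_one]
    have hzsub : a w / c w - 1 = (a - c) w / c w := by rw [Pi.sub_apply]; field_simp
    have hz1' : a w / c w - 1 ≠ 0 := by rw [hzsub]; exact div_ne_zero hx0 hc0
    have hvz1lt : Valued.v (a w / c w - 1) < Valued.v (2 : (w.1.adicCompletion L)) := by
      rw [hzsub, map_div₀, hvc, div_one, hvx, h2v, WithZero.exp_lt_exp]; omega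
    have hvzp : Valued.v (a w / c w + 1) = Valued.v (2 : (w.1.adicCompletion L)) := by
      have h : a w / c w + 1 = (a w / c w - 1) + 2 := by ring
      rw [h, Valuation.map_add_eq_of_lt_right _ hvz1lt]
    have hz1 : a w / c w + 1 ≠ 0 := fun h0 => by
      rw [h0, map_zero] at hvzp
      exact (Valuation.ne_zero_iff _).2 h20 hvzp.symm
    exact exists_units_toPlace_eq_cayley_div L v w hw hση hη0 hz hz1 hz1'
  refine ⟨fun t => if h : IsRegularElt ((t : ((cmDatum L 2 (Matrix.of fun i j : Fin 2 => if i.val + j.val + 1 = 2 then (1 : L) else 0)).Local v × (cmDatum L 1 (Matrix.of fun i j : Fin 1 => if i.val + j.val + 1 = 1 then (1 : L) else 0)).Local v)).1.val : GL (Fin 2) (LocalRing L v)) ∧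
      (-WithZero.log (Valued.v (2 : (w.1.adicCompletion L)))).toNat + 1 ≤ (-WithZero.log (Valued.v ((((P⁻¹).val * ((t : ((cmDatum L 2 (Matrix.of fun i j : Fin 2 => if i.val + j.val + 1 = 2 then (1 : L) else 0)).Local v × (cmDatum L 1 (Matrix.of fun i j : Fin 1 => if i.val + j.val + 1 = 1 then (1 : L) else 0)).Local v)).1.val.val : Matrix (Fin 2) (Fin 2) (LocalRing L v)) * P.val) 0 0 - ((P⁻¹).val * ((t : ((cmDatum L 2 (Matrix.of fun i j : Fin 2 => if i.val + j.val + 1 = 2 then (1 : L) else 0)).Local v × (cmDatum L 1 (Matrix.of fun i j : Fin 1 => if i.val + j.val + 1 = 1 then (1 : L) else 0)).Local v)).1.val.val : Matrix (Fin 2) (Fin 2) (LocalRing L v)) * P.val) 1 1) w))).toNat then (hpt t h.1 h.2).choose else 1,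
    fun t ht hN => ?_⟩
  simp only [dif_pos (And.intro ht hN)]
  exact (hpt t ht hN).choose_spec

end Uniform

end Literature.NumberTheory.Rogawski1990
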